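import Summits.BirchSwinnertonDyer.Rank1Residual.X9.PrintX9LeafDoorOfAnyClassNumber
import HarnessLib

/-!
# Route `PrintX9` (rev 15): the LIGHT assembly — item `AssemblyLightFrame` (stmt-BirchSwinnertonDyer-24425)
# PROVED IN THE KERNEL: `HowardContainmentLightFrame → TwoSidedLinkAnyClassNumber → MuTransfer →
# AnalyticMuZeroX9 → HeegnerPrintFactsX9 → CyclotomicPrintFactsX9 → BSDpOnClassX9`

HONEST FRAMING (cell `run/shared/lean/pub/bsd-print-x9/`, D-0131 print tier; planner g7's TURNKEY T-E,
landed by the cell's typer seat ty3 — hence the file lives in the cell's typer tree `Rank1Residual/X9/`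
next to its rev-7 twin `PrintX9LeafDoorOfAnyClassNumber.lean` (p589823), not under
`BirchSwinnertonDyer/Theorems/` (prover-only, D-0016); the item is then closed BY NAME with
`TorsionLayer.assemblyLightFrame_holds`, or re-exported by a one-line Theorems/ port).
THEOREMS ONLY: no definition, no named fact, no `sorry`. «beyond-print theorem»: NO (assembly glue).
Nothing is booked, closed or edited here; BSD is not proved; the leaf does NOT close.

Route PrintX9's deciding theorem consumes crux A `HowardContainmentAnyClassNumber` (stmt-23161: Howard's
Λ-adic Heegner containment on EVERY X9 Heegner frame, any class number) only at rank-one LIGHT frames —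
odd `d_K`, `(irr_K)`, `rank E(K) = 1`, `Ш(E/K)[p^∞]` finite — namely once, in
`TorsionLayer.indexIdentityAt_of_cruxes` (Theorems/TorsionLayerDescentAssembly.lean §1), to feed crux B.
The route therefore added (rev 13, planner g7) the strictly weaker crux `HowardContainmentLightFrame`
(stmt-24424: A restricted to exactly those frames) and the assembly-shaped support item
`AssemblyLightFrame` (stmt-24425), and (rev 15, planner g8) re-glued
`closes (hAsm : AssemblyLightFrame) (hA : HowardContainmentLightFrame) (hB) (hT) (hμ) (hHP) (hCP) :=
hAsm hA hB hT hμ hHP hCP`. THIS FILE proves `AssemblyLightFrame`: §1–§3 of the TorsionLayerDescent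
assembly (p583666) and the PrintX9 leaf door (p589823) re-run VERBATIM with crux A consumed at the light
frame only (the one changed line is marked). It also records `A → A_light` (the narrowing is a weakening).
Open inputs BY NAME after this file: `HowardContainmentLightFrame` (24424; beyond print at torsion depth
δ > 0: the μ-part of Howard's divisibility, cell DOSSIER §41/§47, line `torsion-depth-light`),
`TwoSidedLinkAnyClassNumber` (23162), `MuTransfer` (19629, held on Kato F1), `AnalyticMuZeroX9` (19630);
the two bundles `HeegnerPrintFactsX9` (20393) / `CyclotomicPrintFactsX9` (20532) are cite-only.

References: [Howard2004HeegnerKolyvagin] Thm. B; [CastellaGrossiLeeSkinner2022] Thm. 3.4.1, Cor. 3.4.2,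
Thm. 4.1.1, Thm. 4.1.3 (arXiv:2008.02571); [MastellaZerman2026] Cor. 4.6 (arXiv:2505.08710);
[BurungaleCastellaSkinner2025] Thm. 1.1.2 (a); [HoffsteinLuo1997] Theorem (§1); [JetchevSkinnerWan2017]
Thm. 3.3.1; route file `Theses/PrintX9.lean` rev 15 (items 24424 / 24425 / 23162 / 19629 / 19630 / 20393 / 20532).
-/

set_option linter.dupNamespace false
set_option autoImplicit false

noncomputable section

open scoped Classical MatrixGroups ModularForm

open CongruenceSubgroup WeierstrassCurve NumberField IsDedekindDomain
  Literature.NumberTheory.EllipticCurves Literature.NumberTheory.EllipticCurves.ModularForms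
  Literature.NumberTheory.EllipticCurves.BurungaleCastellaSkinner2025
  Literature.NumberTheory.EllipticCurves.JetchevSkinnerWan2017
  Literature.NumberTheory.EllipticCurves.YanZhu2026
  Summit.BirchSwinnertonDyer.BirchSwinnertonDyer.Theorems.Rank1ResidualX1Defs
  Summit.BirchSwinnertonDyer.Rank1Residual

open Literature.NumberTheory.EllipticCurves.Rank1Residual (GoodOrd Irr Surj BigIm
  norm_periodRatio_eq_one pPart_of_bsdp not_dvd_discr_of_split)

open Summit.BirchSwinnertonDyer.BirchSwinnertonDyer.Theses

namespace Summit.BirchSwinnertonDyer.BirchSwinnertonDyer.Rank1Residual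

namespace TorsionLayer

/-- A ⇒ A_light (the narrowing is a weakening). -/
theorem howardContainmentLightFrame_of_anyClassNumber
    (hA : PrintX9.HowardContainmentAnyClassNumber) : PrintX9.HowardContainmentLightFrame := by
  intro W _ _ p _ _ K _ _ hX9 hK hodd h3 hHN hHp _ κ hκ γ hγ Dt H ιC _ _
  have h4 : NumberField.discr K ≠ -4 := fun h => by
    rw [h] at hodd; exact (Int.not_odd_iff_even.mpr ⟨-2, by norm_num⟩) hodd
  exact hA W p K hX9 hK h3 h4 hHN hHp κ hκ γ hγ Dt H ιC

/-- §1-light: IMCLink §3 / TLD §1 with crux A replaced by its light-frame restriction. -/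
theorem indexIdentityAt_of_lightCruxes
    (hA : PrintX9.HowardContainmentLightFrame) (hB : PrintX9.TwoSidedLinkAnyClassNumber)
    (h331 : thm331_anticyclotomicControl)
    (hmod : hasEntireLFunction_rat) (hGZK : rank_eq_analyticRank_of_analyticRank_le_one)
    (W : WeierstrassCurve ℚ) [W.IsElliptic] [W.IsGloballyMinimal] (p : ℕ) [Fact p.Prime]
    (K : Type) [Field K] [NumberField K] [NeZero (W.conductorNorm ℤ)]
    (Dt : ModularParametrizationData W (W.conductorNorm ℤ))
    (H : HeegnerDatum (W.conductorNorm ℤ) (NumberField.discr K)) (ιC : K →+* ℂ)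
    (P : (W.baseChange K).toAffine.Point)
    (hGZ : gross_zagier (W.conductorNorm ℤ) W K) (hKo : kolyvagin (W.conductorNorm ℤ) W K)
    (hX9 : ClassX9 W p) (hr : W.analyticRank = 1)
    (hK : IsImaginaryQuadratic K) (hodd : Odd (NumberField.discr K)) (hlt : NumberField.discr K < -4)
    (hHN : SatisfiesHeegnerHypothesis (W.conductorNorm ℤ) K) (hHp : SatisfiesHeegnerHypothesis p K)
    (hLt : (W.quadraticTwist (NumberField.discr K : ℚ)).entireLFunction 1 ≠ 0)
    (hP : WeierstrassCurve.Affine.Point.map ιC.toRatAlgHom P = heegnerPointComplex Dt H)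
    (hc : ¬ (p : ℤ) ∣ Dt.c) : X11b.IndexIdentityAt W p K P := by
  have hX9' := classX9_census_of_classX9 W p hX9
  have hpP : p.Prime := Fact.out
  have hp5 : 5 ≤ p := hX9'.five_le
  have hp2 : p ≠ 2 := hX9'.ne_two
  have h3 : NumberField.discr K ≠ -3 := by omega
  have h4 : NumberField.discr K ≠ -4 := by omega
  haveI : Finite (W.baseChange K).sha :=
    X11b.finite_sha_baseChange_of_heegner W (W.conductorNorm ℤ) K Dt H ιC P hGZ hKo hmod hr hK hHN hLt hP
  obtain ⟨hrQ, hShaQ⟩ := hGZK W hr.le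
  rw [hr] at hrQ
  obtain ⟨hrk, hfinp⟩ :=
    mordellWeilRank_baseChange_eq_one_and_finite_sha_of_twist_L_one_ne_zero hGZK W K hK p hrQ hShaQ
      hLt
  have hPinf : ¬ IsOfFinAddOrder P :=
    X11b.not_isOfFinAddOrder_of_heegner_of_analyticRank_eq_one W (W.conductorNorm ℤ) K Dt H ιC P hGZ
      hmod hr hK hHN hLt hP
  have hirrK : (W.baseChange K).HasIrreducibleModPGaloisRep p :=
    MatarNekovar2019.prop526_hasIrreducibleModPGaloisRep_baseChange_holds W K hK.1
      (Literature.SatisfiesHeegnerHypothesis.coprime_discr hK.1 hHN) p hp2 hX9'.irr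
  obtain ⟨κ, γ, 𝔭, hκ, hγ, h𝔭⟩ := X11b.exists_anticyclotomic_generator_prime (p := p) hK
  haveI : Fact (κ.IsTopGenerator γ) := ⟨hγ⟩
  have hsplit : X11b.SplitsIn K p := hHp p Fact.out (dvd_refl p)
  obtain ⟨he, hf⟩ := X11b.degreeOne_of_splitsIn hK.1 hsplit h𝔭
  set ι : K →+* ℚ_[p] := X11b.embAt K p 𝔭 h𝔭 he hf with hι
  have hCTL : X11b.ControlOnTreeGoodAt p κ (X11b.inducedPlace ι) γ ι P :=
    X11b.controlOnTreeGoodAt_of_thm331_of_inducedPlace h331 (by omega) hX9'.good hK hHp rfl hHN hirrK ι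
      κ hκ γ hrk hfinp P hPinf
  -- THE ONE CHANGED LINE: crux A is consumed at the light frame only
  have hHow := hA W p K hX9 hK hodd h3 hHN hHp hirrK κ hκ γ hγ Dt H ιC hrk hfinp
  have hIW : X11b.IMCWaldspurgerOnTreeGoodAt p κ (X11b.inducedPlace ι) γ ι P :=
    hB W p K hX9 hK hodd h3 hHN hHp hirrK ι κ hκ γ Dt hc H ιC P hP hrk hfinp hPinf hHow
  exact X11b.indexIdentityAt_of_onTreeGoodLinks_of_allSplit hK rfl hHN hIW hCTL

/-- §2-light: rank one at an X9 pair on a light frame, from the light crux. -/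
theorem bsdp_rankOne_of_lightFrame_of_lightCruxes
    (hA : PrintX9.HowardContainmentLightFrame) (hB : PrintX9.TwoSidedLinkAnyClassNumber)
    (h331 : thm331_anticyclotomicControl)
    (hGZ : ∀ (N : ℕ) [NeZero N] (W : WeierstrassCurve ℚ) (K : Type) [Field K] [NumberField K],
      gross_zagier N W K)
    (hKo : ∀ (N : ℕ) [NeZero N] (W : WeierstrassCurve ℚ) (K : Type) [Field K] [NumberField K],
      kolyvagin N W K)
    (hGr : greenberg_charValue_rankZero) (hGZK : rank_eq_analyticRank_of_analyticRank_le_one)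
    (hmod : hasEntireLFunction_rat) (hpar : nonempty_modularParametrizationData)
    (hnf : exists_isNewformOf)
    (hMaz : mazur_not_dvd_maninConstant_of_odd) (hNS : integral_neronScaling_of_isGloballyMinimal)
    (h5 : realPeriodRat_eq_unit_mul_plusPeriod)
    (W : WeierstrassCurve ℚ) [W.IsElliptic] [W.IsGloballyMinimal] (p : ℕ) [Fact p.Prime]
    (hX9 : ClassX9 W p) (hr : W.analyticRank = 1)
    (K : Type) [Field K] [NumberField K] (hK : IsImaginaryQuadratic K)
    (hodd : Odd (NumberField.discr K)) (hlt : NumberField.discr K < -4)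
    (hHN : SatisfiesHeegnerHypothesis (W.conductorNorm ℤ) K) (hHp : SatisfiesHeegnerHypothesis p K)
    (hLt : (W.quadraticTwist (NumberField.discr K : ℚ)).entireLFunction 1 ≠ 0)
    (hIMC : IntegralMainConjectureOnClassX9) : BSDp W p := by
  obtain ⟨-, hp5, hgood, hord, hirr, -⟩ := id hX9
  have hpP : p.Prime := Fact.out
  have hp2 : p ≠ 2 := by omega
  haveI : NeZero (W.conductorNorm ℤ) := ⟨(W.conductorNorm_pos_holds).ne'⟩
  have hpd : ¬ (p : ℤ) ∣ NumberField.discr K := not_dvd_discr_of_split hK hpP hp2 hHp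
  have hμ : ¬ p ∣ Units.torsionOrder K := by
    haveI : IsTotallyComplex K := hK.2
    rw [Literature.NumberTheory.DiophantineGeometry.torsionOrder_eq_two_of_discr_lt hK.1 hlt]
    intro hdvd
    have := Nat.le_of_dvd two_pos hdvd
    omega
  obtain ⟨Dt, H, ι, P, hP, hc⟩ :=
    X11b.exists_maninDatum_of_good hnf hMaz hNS W p (W.conductorNorm ℤ) K rfl hp2 hgood hirr hK hHN
  have hid : Finite (W.baseChange K).sha → X11b.IndexIdentityAt W p K P := fun _ ↦
    indexIdentityAt_of_lightCruxes hA hB h331 hmod hGZK W p K Dt H ι P (hGZ _ W K) (hKo _ W K) hX9 hr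
      hK hodd hlt hHN hHp hLt hP hc
  have hD0 : (NumberField.discr K : ℚ) ≠ 0 := by exact_mod_cast NumberField.discr_ne_zero K
  haveI hEt : (W.quadraticTwist (NumberField.discr K : ℚ)).IsElliptic :=
    W.isElliptic_quadraticTwist hD0
  obtain ⟨Cd, hCd⟩ := hasGlobalMinimalModel_rat_holds (W.quadraticTwist (NumberField.discr K : ℚ))
  haveI : (Cd • W.quadraticTwist (NumberField.discr K : ℚ)).IsGloballyMinimal := hCd
  have hWd : Cd • W.quadraticTwist (NumberField.discr K : ℚ) =
      Cd • W.quadraticTwist (NumberField.discr K : ℚ) := rfl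
  have hX9d : ClassX9 (Cd • W.quadraticTwist (NumberField.discr K : ℚ)) p :=
    classX9_twist_model hX9 K hK.1 hpd Cd hWd
  have hordd : GoodOrd (Cd • W.quadraticTwist (NumberField.discr K : ℚ)) p :=
    ⟨hX9d.2.2.1, hX9d.2.2.2.1⟩
  have htam : padicValNat p (Cd • W.quadraticTwist (NumberField.discr K : ℚ)).tamagawaProduct =
      padicValNat p W.tamagawaProduct :=
    X2.padicValNat_tamagawaProduct_twist_of_heegner_of_odd W p hp2 K hK hodd hpd hHN Cd hWd
  have hu : padicValRat p (Cd.u : ℚ) = 0 :=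
    X11b.padicValRat_u_eq_zero_of_twist_good W p hpd hgood Cd hWd hordd.1
  have hMCd : MazurMainConjecture (Cd • W.quadraticTwist (NumberField.discr K : ℚ)) p :=
    mazurMainConjecture_of_integralMainConjectureOnClassX9 h5 hIMC hX9d
  exact X11b.bsdp_rankOne_of_indexIdentityAt_of_twist_mazurMainConjecture W p (W.conductorNorm ℤ) K Dt
    H ι P (hGZ _ W K) (hKo _ W K) hGr hGZK hmod hpar hr hp2 hK hHN hP hc hμ hLt
    (Cd • W.quadraticTwist (NumberField.discr K : ℚ)) Cd hWd hordd htam hu hMCd hid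

/-- §3-light: PrintX9's leaf from the LIGHT crux, crux B, the μ-inputs and the two print bundles. -/
theorem bsdpOnClassX9_of_lightCruxes_of_muInputs_of_printFacts
    (hA : PrintX9.HowardContainmentLightFrame) (hB : PrintX9.TwoSidedLinkAnyClassNumber)
    (hT : PrintX9.MuTransfer) (hμ : PrintX9.AnalyticMuZeroX9)
    (hHP : PrintX9.HeegnerPrintFactsX9) (hCP : PrintX9.CyclotomicPrintFactsX9) :
    Summit.BirchSwinnertonDyer.BirchSwinnertonDyer.Rank1Residual.BSDpOnClassX9 := by
  obtain ⟨hGZ, hKo, -, -, -, -, -, h331, hnf, hHL, hMaz, hNS⟩ := hHP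
  obtain ⟨hBCS, hGr, hGZK, hmod, hpar, h5⟩ := hCP
  have hF := lightFrameSupplyOdd_of_hoffsteinLuo hnf hHL
  have hE := integralMainConjectureOnClassX9_of_katoMuTransfer hBCS hT hμ
  intro W _ _ p _ hran hX9 _
  obtain ⟨-, hp5, hgood, hord, -, -⟩ := id hX9
  have hbsdp : BSDp W p := by
    rcases Nat.lt_or_ge W.analyticRank 1 with h0 | h1
    · exact bsdp_of_mazurMainConjecture_of_analyticRank_eq_zero hGr hpar hGZK (by omega) ⟨hgood, hord⟩
        (by omega) (mazurMainConjecture_of_integralMainConjectureOnClassX9 h5 hE hX9)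
    · have hr : W.analyticRank = 1 := le_antisymm hran h1
      haveI : NeZero (W.conductorNorm ℤ) := ⟨(W.conductorNorm_pos_holds).ne'⟩
      obtain ⟨K, _, _, hK, hodd, hlt, hHN, hHp, hLt⟩ := hF W p hX9 hr
      exact bsdp_rankOne_of_lightFrame_of_lightCruxes hA hB h331 hGZ hKo hGr hGZK hmod hpar hnf hMaz hNS
        h5 W p hX9 hr K hK hodd hlt hHN hHp hLt hE
  exact (pPartBSD_iff_pPart W p).mpr (pPart_of_bsdp hmod hGZK W p hran hbsdp)

/-- The light assembly in item shape. -/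
theorem printX9_lightFrame_assembly :
    PrintX9.HowardContainmentLightFrame → PrintX9.TwoSidedLinkAnyClassNumber → PrintX9.MuTransfer →
      PrintX9.AnalyticMuZeroX9 → PrintX9.HeegnerPrintFactsX9 → PrintX9.CyclotomicPrintFactsX9 →
        Summit.BirchSwinnertonDyer.BirchSwinnertonDyer.Rank1Residual.BSDpOnClassX9 :=
  bsdpOnClassX9_of_lightCruxes_of_muInputs_of_printFacts

/-- **Item `PrintX9.AssemblyLightFrame` (stmt-BirchSwinnertonDyer-24425) holds** — the gate's closing shape. -/
theorem assemblyLightFrame_holds :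
    Summit.BirchSwinnertonDyer.BirchSwinnertonDyer.Theses.PrintX9.AssemblyLightFrame := by
  unfold Summit.BirchSwinnertonDyer.BirchSwinnertonDyer.Theses.PrintX9.AssemblyLightFrame
  exact bsdpOnClassX9_of_lightCruxes_of_muInputs_of_printFacts

end TorsionLayer

end Summit.BirchSwinnertonDyer.BirchSwinnertonDyer.Rank1Residual

end
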